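import Summits.KontsevichZagierPeriods.Zeta5Search.LaiSweepShard

/-!
# `κ₃` sweep certificate — shard file 123 of 127 (shards 861–867 of 889)

HONEST FRAMING. Systematic search; no irrationality claim unless certified. This file only checks,
by `decide +kernel`, shards 861–867 of the order-cell sweep of the `κ₃` point `(74, 2180, 444; δ74)`
(engine `LaiSweepEngine`, soundness `LaiSweepJump/Free/Eval/Shard/Kappa3`; a shard is `⟨regime, n,
p, q, p', q', Lo, Up⟩`: `n` cells from `p/q` to `p'/q'` with integer rate sums in `[Lo, Up]`, `K =
128`, `D = 2^40`). It draws NO conclusion: only the capstone `LaiKappa3SweepCert`, which needs all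
127 shard files, does. Kernel cost of this file ≈ 560 cells × 0.3 s.
-/

namespace Summit.KontsevichZagierPeriods.Zeta5Search.Sweep

set_option maxHeartbeats 100000000 in
/-- Shard 861: 80 cells of regime B from `306/317` to `260/269`.
[cite: Lai2024BallRivoal, §4 Lemma 4.3] -/
theorem shard861 :
    Shard.check 128 (2^40)
      ⟨true, 80, 306, 317, 260, 269, 9983921759684, 17799557557075⟩ = true := by
  decide +kernel

set_option maxHeartbeats 100000000 in
/-- Shard 862: 80 cells of regime B from `260/269` to `331/342`.
[cite: Lai2024BallRivoal, §4 Lemma 4.3] -/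
theorem shard862 :
    Shard.check 128 (2^40)
      ⟨true, 80, 260, 269, 331, 342, 10381328592308, 18527111324281⟩ = true := by
  decide +kernel

set_option maxHeartbeats 100000000 in
/-- Shard 863: 80 cells of regime B from `331/342` to `94/97`.
[cite: Lai2024BallRivoal, §4 Lemma 4.3] -/
theorem shard863 :
    Shard.check 128 (2^40)
      ⟨true, 80, 331, 342, 94, 97, 9913577612441, 17710426640148⟩ = true := by
  decide +kernel

set_option maxHeartbeats 100000000 in
/-- Shard 864: 80 cells of regime B from `94/97` to `163/168`.
[cite: Lai2024BallRivoal, §4 Lemma 4.3] -/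
theorem shard864 :
    Shard.check 128 (2^40)
      ⟨true, 80, 94, 97, 163, 168, 9343974053066, 16709080390356⟩ = true := by
  decide +kernel

set_option maxHeartbeats 100000000 in
/-- Shard 865: 80 cells of regime B from `163/168` to `239/246`.
[cite: Lai2024BallRivoal, §4 Lemma 4.3] -/
theorem shard865 :
    Shard.check 128 (2^40)
      ⟨true, 80, 163, 168, 239, 246, 10467884577963, 18737627971408⟩ = true := by
  decide +kernel

set_option maxHeartbeats 100000000 in
/-- Shard 866: 80 cells of regime B from `239/246` to `393/404`.
[cite: Lai2024BallRivoal, §4 Lemma 4.3] -/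
theorem shard866 :
    Shard.check 128 (2^40)
      ⟨true, 80, 239, 246, 393, 404, 9825991247776, 17606642669814⟩ = true := by
  decide +kernel

set_option maxHeartbeats 100000000 in
/-- Shard 867: 80 cells of regime B from `393/404` to `75/77`.
[cite: Lai2024BallRivoal, §4 Lemma 4.3] -/
theorem shard867 :
    Shard.check 128 (2^40)
      ⟨true, 80, 393, 404, 75, 77, 10031877629893, 17993608082850⟩ = true := by
  decide +kernel

/-- The checked shards of this file, in order. [folklore] -/
def shards123 : List (CheckedShard 128 (2^40)) :=
  [⟨_, shard861⟩, ⟨_, shard862⟩, ⟨_, shard863⟩, ⟨_, shard864⟩, ⟨_, shard865⟩,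
    ⟨_, shard866⟩, ⟨_, shard867⟩]

end Summit.KontsevichZagierPeriods.Zeta5Search.Sweep
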